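import Mathlib
import HarnessLib
/-!
# HodgeLocusCensusScrollRows — the (4,4) Aoki–Shioda 'α' cell δ = [Z] − [Π] identified as a cubic-scroll class (cell pub-hlocus, referee gen 15, REFEREE.md R29)
HONEST FRAMING: certified instances and evidence bearing on the general Hodge conjecture; no claim.

Setting (engine B row `(4,4) | linear [(0,1,1),(2,3,1),(4,5,1)] | λ = −1: rank 12 / e = 4 (α)`): X_F ⊂ ℙ⁵ the Fermat quartic fourfold,
H = {x₄ = ζ₈ x₅}, so X_F ∩ H is the cone with vertex p = (0,0,0,0,ζ₈,1) over the Fermat quartic K3 surface S_F ⊂ ℙ³.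
Z = cone_p(E), E = V(f₁, f₂) ⊂ S_F the elliptic quartic of the Aoki–Shioda block (f₁ = x₂² − κx₀x₁, g₁ = x₂² + κx₀x₁, f₂ = x₀² + x₁² + i x₃²,
g₂ = x₀² + x₁² − i x₃², κ = ζ₈ + ζ₈⁷ = √2, i = ζ₈²); Π = cone_p(L), L = V(x₀ − ζ₈x₁, x₂ − ζ₈x₃) ⊂ S_F a line.
Kernel-checked here: (1) the LIAISON identity f₁g₁ + f₂g₂ = (f₁ + g₂)g₁ + (f₂ − g₁)g₂, so V(f₁ + g₂, f₂ − g₁) ⊂ S_F is a (2,2) complete intersection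
residual to E' = V(f₁, g₂) in the quadric section {f₁ + g₂ = 0}, hence linearly equivalent to E on S_F; (2) f₁ + g₂ and f₂ − g₁ VANISH on L
(any commutative ring with ζ⁸ = 1), so V(f₁ + g₂, f₂ − g₁) = L ∪ C; (3) E ∩ L = ∅ over any field of characteristic ≠ 2 with ζ⁴ = −1;
(4) the K3-lattice and dimension bookkeeping: (E − L)² = −2, (E − L)·h = 3 (so E − L ∼ C is an effective class of degree 3, arithmetic genus 0:
the twisted cubic, Hilbert function 3k + 1), h⁰(𝒪_{S(1,2)}(4)) = 35 by Riemann–Roch on 𝔽₁ (H² = 3, H·K = −5), h⁰(I_S(4)) = 126 − 35 = 91,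
dim{cubic scrolls in ℙ⁵} = 5 + 18 = 23, 23 + 91 = 114 = 126 − 12 = dim T_{X_F} V_δ.
Consequence (REFEREE.md R29, argument as R20): δ = [cone_p(C)] and V_δ is smooth at X_F of codimension 12, equal near X_F to the closure of the
locus of quartic fourfolds containing a cubic scroll (S(1,2), degenerating to the cone S(0,3) = cone_p(C) at X_F): EXPLAINED-SMOOTH, strictly
larger than V_{[Z]} ∩ V_{[Π]} (tangent dimension 110). The mod-p certificates (I_{cone C}(4) ⊆ ker M_δ, 91/91; generic finiteness rank 114; two
primes) are `data/ivhs/census/refg15/ref_as_scroll.json`; they are cited evidence, not Lean theorems.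
-/
namespace Summit.HodgeConjecture.HodgeConjecture.HodgeLocus.Census.Scroll

variable {R : Type*} [CommRing R]

/-- (1) liaison identity behind L ∪ C = V(f₁ + g₂, f₂ − g₁) ⊂ S_F: Σ fᵢgᵢ = (f₁ + g₂)g₁ + (f₂ − g₁)g₂ for ANY f₁ g₁ f₂ g₂. -/
theorem liaison (f₁ g₁ f₂ g₂ : R) : f₁ * g₁ + f₂ * g₂ = (f₁ + g₂) * g₁ + (f₂ - g₁) * g₂ := by ring

/-- (2) on the line L = {x₀ = ζx₁, x₂ = ζx₃} the quadric f₁ + g₂ = x₂² − κx₀x₁ + x₀² + x₁² − i x₃² vanishes (κ = ζ + ζ⁷, i = ζ², ζ⁸ = 1). -/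
theorem A_on_L (ζ x₁ x₃ : R) (h : ζ ^ 8 = 1) :
    (ζ * x₃) ^ 2 - (ζ + ζ ^ 7) * (ζ * x₁) * x₁ + (ζ * x₁) ^ 2 + x₁ ^ 2 - ζ ^ 2 * x₃ ^ 2 = 0 := by
  linear_combination (-(x₁ ^ 2)) * h

/-- (2') on L the quadric f₂ − g₁ = x₀² + x₁² + i x₃² − x₂² + κx₀x₁ ... with the sign convention f₂ − g₁ = (x₀² + x₁² + i x₃²) − (x₂² + κx₀x₁) vanishes. -/
theorem B_on_L (ζ x₁ x₃ : R) (h : ζ ^ 8 = 1) :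
    ((ζ * x₁) ^ 2 + x₁ ^ 2 + ζ ^ 2 * x₃ ^ 2) - ((ζ * x₃) ^ 2 + (ζ + ζ ^ 7) * (ζ * x₁) * x₁) = 0 := by
  linear_combination (-(x₁ ^ 2)) * h

/-- (3) E ∩ L = ∅: over a field of characteristic ≠ 2 with ζ⁴ = −1, a point of L on both f₁ = x₂² − κx₀x₁ and f₂ = x₀² + x₁² + i x₃² is the origin. -/
theorem E_cap_L_empty {K : Type*} [Field K] (h2 : (2 : K) ≠ 0) (ζ x₁ x₃ : K) (hζ : ζ ^ 4 = -1)
    (hf₁ : (ζ * x₃) ^ 2 - (ζ + ζ ^ 7) * (ζ * x₁) * x₁ = 0)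
    (hf₂ : (ζ * x₁) ^ 2 + x₁ ^ 2 + ζ ^ 2 * x₃ ^ 2 = 0) : x₁ = 0 ∧ x₃ = 0 := by
  have h8 : ζ ^ 8 = 1 := by
    have : ζ ^ 8 = (ζ ^ 4) ^ 2 := by ring
    rw [this, hζ]; norm_num
  -- f₂ − f₁ on L = 2(1 + ζ²) x₁²
  have hsum : 2 * (1 + ζ ^ 2) * x₁ ^ 2 = 0 := by
    linear_combination hf₂ - hf₁ - x₁ ^ 2 * h8
  have hunit : (1 + ζ ^ 2) ≠ 0 := by
    intro h0
    have : (1 + ζ ^ 2) * (1 - ζ ^ 2) = 2 := by linear_combination (-1 : K) * hζ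
    rw [h0, zero_mul] at this
    exact h2 this.symm
  have hx₁ : x₁ = 0 := by
    have : x₁ ^ 2 = 0 := by
      rcases mul_eq_zero.1 hsum with h | h
      · rcases mul_eq_zero.1 h with h | h
        · exact absurd h h2
        · exact absurd h hunit
      · exact h
    exact pow_eq_zero_iff (two_ne_zero) |>.1 this
  have hζ0 : ζ ≠ 0 := by
    intro h0; rw [h0] at hζ; norm_num at hζ
  refine ⟨hx₁, ?_⟩
  subst hx₁
  have : ζ ^ 2 * x₃ ^ 2 = 0 := by linear_combination hf₂
  rcases mul_eq_zero.1 this with h | h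
  · exact absurd (pow_eq_zero_iff two_ne_zero |>.1 h) hζ0
  · exact pow_eq_zero_iff two_ne_zero |>.1 h

/-- (4a) K3-lattice bookkeeping on S_F: with E² = 0, L² = −2, E·L = 0, E·h = 4, L·h = 1, h² = 4:
(E − L)² = −2 and (E − L)·h = 3 (effective by Riemann–Roch: the twisted cubic C); for the twist cell E·E' = 4 (mod-p Hilbert function):
(E − E' + k h)² = −8 + 4k² for k = 0, 1, 2 (no (−2)- or 0-class of positive degree at k = 1: −4). -/
theorem k3_lattice :
    (0 : ℤ) - 2 * 0 + (-2) = -2 ∧ (4 : ℤ) - 1 = 3 ∧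
    (∀ k : ℤ, (0 : ℤ) + 0 - 2 * 4 + 2 * k * (4 - 4) + 4 * k ^ 2 = -8 + 4 * k ^ 2) := by
  refine ⟨by norm_num, by norm_num, fun k => by ring⟩

/-- (4b) dimension bookkeeping: dim S₄(ℂ⁶) = C(9,4) = 126; h⁰(𝒪_{𝔽₁}(4H)) = 1 + ((4H)² − 4H·K)/2 = 1 + (48 + 20)/2 = 35 (H² = 3, H·K = −5);
h⁰(I_S(4)) = 91; cubic scrolls in ℙ⁵: 5 + (24 − 6) = 23; 23 + 91 = 114 = 126 − 12; tangent space of the cone family at X_F: 110 < 114;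
twisted cubic: h⁰(I_C(k)) = C(k+3,3) − (3k+1) = 0, 3, 10, 22 for k = 1..4 (engine R C2, two primes). -/
theorem dimension_bookkeeping :
    Nat.choose 9 4 = 126 ∧ 16 * 3 = 48 ∧ 4 * 5 = 20 ∧ 1 + (48 + 20) / 2 = 35 ∧ 126 - 35 = 91 ∧
    5 + (24 - 6) = 23 ∧ 23 + 91 = 114 ∧ 126 - 12 = 114 ∧ 110 < 114 ∧
    (List.range 4).map (fun j => Nat.choose (j + 4) 3 - (3 * (j + 1) + 1)) = [0, 3, 10, 22] := by decide

/-- the generic-finiteness count behind C5: the stabiliser of a cubic scroll spanning a hyperplane in GL₆ has dimension 36 − 23 = 13,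
so rank(I_S(4) + gl₆·q₀) ≤ 91 + 23 = 114, with equality measured at a random point (two primes). -/
theorem orbit_count : 36 - 13 = 23 ∧ 91 + 23 = 114 := by decide

end Summit.HodgeConjecture.HodgeConjecture.HodgeLocus.Census.Scroll
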